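import Summits.QuantumFields.GaugeBoot.Certificates.SparseReducedTrace
import HarnessLib

/-!
# Sparse certificate replay, part 4b: the cover check split by block rows

HONEST FRAMING (cell `pub-gaugeboot`): certified bounds on lattice expectations at stated coupling,
gauge group, dimension and torus size; NOT a mass gap, NOT a continuum limit, NOT a string tension;
NOT Yang–Mills-summit-bearing (barriers `FixedCouplingUltralocality`, `PerturbativeInvisibility`).

`Certificates/SparseReducedTrace.lean` checks the cover property (`EntCoverOK`: every term of every
entry of a reduced block is listed in the position list of its variable) one block range at a time
(`entCoverCheck … klo khi`).  For the glyz-c2-4D family (`N2c2D4`: 34 blocks ≤ 42, 151 019 positions,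
position lists of up to 1 498 triples) a single block costs up to ≈ 60 s of kernel time, above what one
`decide +kernel` reliably gets on the farm.  This module splits the same check by ROWS of one block:
`entCoverCheckRows EB P2 B m k ilo ihi` (rows `ilo ≤ i < ihi` of block `k`), its meaning
`EntCoverRowsOK`, soundness, concatenation of row ranges, and the step back to the block statement
`EntCoverOK EB P2 B m k (k+1)` (`EntCoverRowsOK.toBlock`), which then concatenates over blocks with
`EntCoverOK.append` as before.  All `[folklore]`; nothing is claimed about lattice gauge theory.
-/

namespace Summit.QuantumFields.GaugeBoot.Certificates.Sparse

open Matrix Finset Literature.Computation.Certificates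

noncomputable section

/-- Cover check for block `k`, rows `ilo ≤ i < ihi`: for every column `j < m`, every term `(w, c)` of
the (transposed) entry `ent k j i` has `(k, i, j)` listed in `P[w]`. [folklore] -/
def entCoverCheckRows (EB : List (List (List (List (ℕ × ℤ))))) (P2 : List (List (List (ℕ × ℕ × ℕ))))
    (B m k ilo ihi : ℕ) : Bool :=
  natAll (ihi - ilo) fun t => natAll m fun j =>
    (ent EB k j (ilo + t)).all fun p => memTriple k (ilo + t) j (getP P2 B p.1)

/-- What `entCoverCheckRows` establishes. [folklore] -/
def EntCoverRowsOK (EB : List (List (List (List (ℕ × ℤ))))) (P2 : List (List (List (ℕ × ℕ × ℕ))))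
    (B m k ilo ihi : ℕ) : Prop :=
  ∀ i, ilo ≤ i → i < ihi → ∀ j < m, ∀ p ∈ ent EB k j i, (k, i, j) ∈ getP P2 B p.1

/-- Soundness of `entCoverCheckRows`. [folklore] -/
theorem entCoverRowsOK_of_check {EB : List (List (List (List (ℕ × ℤ))))}
    {P2 : List (List (List (ℕ × ℕ × ℕ)))} {B m k ilo ihi : ℕ}
    (h : entCoverCheckRows EB P2 B m k ilo ihi = true) : EntCoverRowsOK EB P2 B m k ilo ihi := by
  intro i hlo hhi j hj p hp
  have h1 := natAll_iff.mp (natAll_iff.mp h (i - ilo) (by omega)) j hj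
  rw [show ilo + (i - ilo) = i by omega] at h1
  exact memTriple_iff.mp (List.all_eq_true.mp h1 p hp)

/-- Concatenating row ranges of one block. [folklore] -/
theorem EntCoverRowsOK.append {EB : List (List (List (List (ℕ × ℤ))))}
    {P2 : List (List (List (ℕ × ℕ × ℕ)))} {B m k ilo imid ihi : ℕ}
    (h1 : EntCoverRowsOK EB P2 B m k ilo imid) (h2 : EntCoverRowsOK EB P2 B m k imid ihi) :
    EntCoverRowsOK EB P2 B m k ilo ihi :=
  fun i hlo hhi => if hm : i < imid then h1 i hlo hm else h2 i (Nat.le_of_not_lt hm) hhi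

/-- All `m` rows of block `k` covered ⇒ the block-range statement for `k ≤ · < k + 1`. [folklore] -/
theorem EntCoverRowsOK.toBlock {EB : List (List (List (List (ℕ × ℤ))))}
    {P2 : List (List (List (ℕ × ℕ × ℕ)))} {B m k : ℕ}
    (h : EntCoverRowsOK EB P2 B m k 0 m) : EntCoverOK EB P2 B m k (k + 1) := by
  intro k' hlo hhi i hi j hj p hp
  obtain rfl : k' = k := by omega
  exact h i (Nat.zero_le _) hi j hj p hp

end

end Summit.QuantumFields.GaugeBoot.Certificates.Sparse
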